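import Mathlib
import Summits.ResolutionOfSingularities.ResolutionOfSingularities.Theorems.WeightedInvariantLocalWeightedDropTOT2NearDir
import Summits.ResolutionOfSingularities.ResolutionOfSingularities.Theorems.WeightedInvariantLocalWeightedDropTOT2NearCurve

/-!
# `WeightedInvariant.LocalWeightedDrop`, TOT₂ line: THE RESTRICTION IDENTITY AT A WEIGHTED CHART (curve moves) — on the slice plane and off the
# parameter letters, the successor's degree-`o` form is the degree-`o` form of `f`

Crux item stmt-ResolutionOfSingularities-8899 `LocalWeightedDrop` (route `ResolutionOfSingularities/WeightedInvariant`), ENGINE skeleton v32/v33; S-E2-SURF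
design memo `L/res-L1-w43-stub-4/g5/S-E2-SURF.md` §9 (persistence of `e ≤ 2` along the curve move).  [OURS · L1 W4.3 · chain w43 · seat res-L1-w43-stub-4
gen 5; def-free; the weighted-chart twin of res-L1-w43-stub-3's `TOT2Near.initEval_slice_cons_zero` (…TOT2NearDir §2), same proof with their weighted
Taylor identity `taylorSum_eq_coeff_slice_w` (…TOT2NearCurve); nothing here is a statement of any manuscript; AI-produced, gate-checked, weaker than
expert review.]

* **`initEval_slice_cons_zero_w`** — for weights `w ∈ {0,1}^{n+1}`, chart convention `w_l = 0 → c_l = 0`, `o ≤ weightedOrder_w f`,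
  `f(chart_{w,c}) = s^o · G`, live slot `i₀`: for every vector `v′` of the new letters VANISHING ON THE PARAMETER LETTERS (`w = 0`),
  `in_o G′(0, v′) = in_o f(v′ ↑ i₀)` (`G′ = G|_{y_{i₀} = 0}`).  With `v′` unrestricted this fails for curve moves (the `s⁰`-layer of `G` carries the
  terms `u^β · (…)` of the `w`-initial form); on the parameter-free slice plane the `s⁰`-coefficients in degree `o` are the top Taylor coefficients.
-/

set_option linter.dupNamespace false -- mandated namespace of this single-conjunct summit

noncomputable section

namespace Summit.ResolutionOfSingularities.ResolutionOfSingularities.Theorems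

namespace TOT2Near

open MvPowerSeries Literature.AlgebraicGeometry.Resolution

variable {k : Type} [Field k]

/-- **THE RESTRICTION IDENTITY AT A WEIGHTED CHART** (see the module docstring). -/
theorem initEval_slice_cons_zero_w {n : ℕ} (w : Fin (n + 1) → ℕ) (c : Fin (n + 1) → k) (hw : ∀ l, w l ≤ 1)
    (hc0 : ∀ l, w l = 0 → c l = 0) (i₀ : Fin (n + 1)) (f : MvPowerSeries (Fin (n + 1)) k) {o : ℕ}
    (hperm : (o : ℕ∞) ≤ f.weightedOrder w) {G : MvPowerSeries (Fin (n + 1 + 1)) k}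
    (hfac : subst (CobordantChart.chart w c) f = X 0 ^ o * G) (v' : Fin n → k) (hv : ∀ j, w (i₀.succAbove j) = 0 → v' j = 0) :
    CobordantChart.initEval (fun _ : Fin (n + 1) => 1) (Fin.cons (0 : k) v') o (TupleGame.slice i₀ G) =
      CobordantChart.initEval (fun _ : Fin (n + 1) => 1) (Fin.insertNth i₀ (0 : k) v') o f := by
  classical
  -- the common value: the sum over the exponents `τ` of the slice plane of degree `o`
  set S : k := ∑ τ ∈ (Finset.univ : Finset (Fin n)).finsuppAntidiag o,
      coeff (Finsupp.mapDomain i₀.succAbove τ) f * ∏ j, v' j ^ τ j with hS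
  -- the `s⁰`-coefficients of `G′` in degree `o`
  have hcoeff : ∀ τ : Fin n →₀ ℕ, τ.degree = o → (∀ j, w (i₀.succAbove j) = 0 → τ j = 0) →
      coeff (Finsupp.cons 0 τ) (TupleGame.slice i₀ G) = coeff (Finsupp.mapDomain i₀.succAbove τ) f := by
    intro τ hτ hτw
    have hβ0 : Finsupp.mapDomain i₀.succAbove τ i₀ = 0 := CoeffTransport.mapDomain_succAbove_apply_self i₀ τ
    have hres : (Finsupp.equivFunOnFinite.symm fun j => Finsupp.mapDomain i₀.succAbove τ (i₀.succAbove j)) = τ := by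
      ext j
      simp [CoeffTransport.mapDomain_succAbove_apply_succAbove]
    have hβw : ∀ l, w l = 0 → Finsupp.mapDomain i₀.succAbove τ l = 0 := by
      intro l hl
      rcases Fin.eq_self_or_eq_succAbove i₀ l with rfl | ⟨j, rfl⟩
      · exact hβ0
      · rw [CoeffTransport.mapDomain_succAbove_apply_succAbove]
        exact hτw j hl
    have h := taylorSum_eq_coeff_slice_w w c hw hc0 i₀ f hperm (Finsupp.mapDomain i₀.succAbove τ) hβ0 hβw
    rw [hres, hfac, NCTransport.slice_X_zero_pow_mul', CoeffTransport.coeff_cons_X_pow_mul] at h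
    rw [← h, taylorSum_of_degree_eq f c]
    rw [← degree_restrict i₀ _ hβ0, hres, hτ]
  -- LHS = S
  have hL : CobordantChart.initEval (fun _ : Fin (n + 1) => 1) (Fin.cons (0 : k) v') o (TupleGame.slice i₀ G) = S := by
    rw [ApexFreeOrderDrop.initEval_one_eq_sum]
    -- kill the exponents with positive `s`-degree
    rw [← Finset.sum_filter_add_sum_filter_not _ (fun E : Fin (n + 1) →₀ ℕ => E 0 = 0)]
    rw [Finset.sum_eq_zero (s := ((Finset.univ : Finset (Fin (n + 1))).finsuppAntidiag o).filter fun E => ¬ E 0 = 0)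
      (fun E hE => by
        rw [Finset.mem_filter] at hE
        rw [Fin.prod_univ_succ, Fin.cons_zero, zero_pow hE.2, zero_mul, mul_zero]), add_zero]
    -- reindex the exponents `(0, τ)` by `τ`
    rw [hS]
    refine Finset.sum_bij' (fun E _ => Finsupp.tail E) (fun τ _ => Finsupp.cons 0 τ) ?_ ?_ ?_ ?_ ?_
    · intro E hE
      rw [Finset.mem_filter] at hE
      have hE' : E ∈ (Finset.univ : Finset (Fin (n + 1))).finsuppAntidiag o := hE.1
      rw [ApexFreeOrderDrop.mem_antidiag_iff, ApexFreeOrderDrop.weight_one_eq_degree] at hE' ⊢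
      rw [← hE', ← Finsupp.cons_tail E, hE.2, CoeffTransport.degree_cons_zero, Finsupp.tail_cons]
    · intro τ hτ
      rw [Finset.mem_filter, Finsupp.cons_zero]
      refine ⟨?_, rfl⟩
      rw [ApexFreeOrderDrop.mem_antidiag_iff, ApexFreeOrderDrop.weight_one_eq_degree] at hτ ⊢
      rw [CoeffTransport.degree_cons_zero, hτ]
    · intro E hE
      rw [Finset.mem_filter] at hE
      conv_rhs => rw [← Finsupp.cons_tail E]
      rw [hE.2]
    · intro τ _
      exact Finsupp.tail_cons 0 τ
    · intro E hE
      rw [Finset.mem_filter] at hE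
      have hE0 : E = Finsupp.cons 0 (Finsupp.tail E) := by
        conv_lhs => rw [← Finsupp.cons_tail E]
        rw [hE.2]
      have hdeg : (Finsupp.tail E).degree = o := by
        have h1 : E ∈ (Finset.univ : Finset (Fin (n + 1))).finsuppAntidiag o := hE.1
        rw [ApexFreeOrderDrop.mem_antidiag_iff, ApexFreeOrderDrop.weight_one_eq_degree, hE0, CoeffTransport.degree_cons_zero] at h1
        exact h1
      by_cases hτw : ∀ j, w (i₀.succAbove j) = 0 → (Finsupp.tail E) j = 0
      · rw [hE0, hcoeff _ hdeg hτw, Finsupp.tail_cons, Fin.prod_univ_succ, Finsupp.cons_zero, pow_zero, one_mul]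
        simp only [Fin.cons_succ, Finsupp.cons_succ]
      · -- a weight-`0` letter occurs: both products vanish (`v′` vanishes there)
        push Not at hτw
        obtain ⟨j, hj, hτj⟩ := hτw
        have hzero : ∏ j', v' j' ^ (Finsupp.tail E) j' = 0 :=
          Finset.prod_eq_zero (Finset.mem_univ j) (by rw [hv j hj, zero_pow hτj])
        rw [hE0, Finsupp.tail_cons, Fin.prod_univ_succ, Finsupp.cons_zero, pow_zero, one_mul]
        simp only [Fin.cons_succ, Finsupp.cons_succ]
        rw [hzero, mul_zero, mul_zero]
  -- RHS = S
  have hR : CobordantChart.initEval (fun _ : Fin (n + 1) => 1) (Fin.insertNth i₀ (0 : k) v') o f = S := by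
    rw [ApexFreeOrderDrop.initEval_one_eq_sum]
    rw [← Finset.sum_filter_add_sum_filter_not _ (fun e : Fin (n + 1) →₀ ℕ => e i₀ = 0)]
    rw [Finset.sum_eq_zero (s := ((Finset.univ : Finset (Fin (n + 1))).finsuppAntidiag o).filter fun e => ¬ e i₀ = 0)
      (fun e he => by
        rw [Finset.mem_filter] at he
        rw [Fin.prod_univ_succAbove _ i₀, Fin.insertNth_apply_same, zero_pow he.2, zero_mul, mul_zero]), add_zero]
    rw [hS]
    refine Finset.sum_bij' (fun e _ => Finsupp.equivFunOnFinite.symm fun j => e (i₀.succAbove j))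
      (fun τ _ => Finsupp.mapDomain i₀.succAbove τ) ?_ ?_ ?_ ?_ ?_
    · intro e he
      rw [Finset.mem_filter] at he
      have he' : e ∈ (Finset.univ : Finset (Fin (n + 1))).finsuppAntidiag o := he.1
      rw [ApexFreeOrderDrop.mem_antidiag_iff, ApexFreeOrderDrop.weight_one_eq_degree] at he' ⊢
      rw [degree_restrict i₀ e he.2, he']
    · intro τ hτ
      rw [Finset.mem_filter]
      refine ⟨?_, CoeffTransport.mapDomain_succAbove_apply_self i₀ τ⟩
      rw [ApexFreeOrderDrop.mem_antidiag_iff, ApexFreeOrderDrop.weight_one_eq_degree] at hτ ⊢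
      rw [← degree_restrict i₀ _ (CoeffTransport.mapDomain_succAbove_apply_self i₀ τ)]
      have hres : (Finsupp.equivFunOnFinite.symm fun j => Finsupp.mapDomain i₀.succAbove τ (i₀.succAbove j)) = τ := by
        ext j
        simp [CoeffTransport.mapDomain_succAbove_apply_succAbove]
      rw [hres, hτ]
    · intro e he
      rw [Finset.mem_filter] at he
      exact mapDomain_succAbove_restrict i₀ e he.2
    · intro τ _
      ext j
      simp [CoeffTransport.mapDomain_succAbove_apply_succAbove]
    · intro e he
      rw [Finset.mem_filter] at he
      rw [mapDomain_succAbove_restrict i₀ e he.2, Fin.prod_univ_succAbove _ i₀, Fin.insertNth_apply_same, he.2, pow_zero, one_mul]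
      simp only [Fin.insertNth_apply_succAbove, Finsupp.coe_equivFunOnFinite_symm]
  rw [hL, hR]

end TOT2Near

end Summit.ResolutionOfSingularities.ResolutionOfSingularities.Theorems

end
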